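import Literature.MathematicalPhysics.QuantumFieldTheory.Balaban1983to89.B7Prop3GeneralRotated
import Literature.MathematicalPhysics.QuantumFieldTheory.Balaban1983to89.B7Prop2Explicit

/-!
# `Balaban1983to89.B7Prop4CurlTransportRec` — THE TWISTED TRANSPORT (58) vs ITS LINEARISATION, QUANTITATIVELY: `‖(R_{0,y}e^{A})(Γ) − 1 − (R_{0,y}A)(Γ)‖ ≤ e^{|Γ||A|} − 1 − |Γ||A|`,
# and THE COVARIANT PLAQUETTE CURL OF `A` READ FROM THE PLAQUETTE VARIABLES OF `e^{A}V₀` AND `V₀` ([Balaban1985Averaging] (44), (58); the curvature source of road (A′))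

statement-level skeleton of published theorems with citation tags; proofs where landed; nothing here is a claim about the Yang–Mills mass gap

CITATION HEADER (lean-in-tree rule).  Cell `pub-ymgap`, seat `pub-ymgap-dag-n05-e` g36 (N05-REC LEAD PEN); item R1 ([3] layer), road (A′) of director-ym №257∕№265∕№266 — the lemma
that feeds the curvature source of the record's (128)∕(131) induction: the N2 estimate bounds the carried gauge letter by `P = sup‖(R_{0,x}A)(∂p)‖` (`B7Prop3GaugeCarryRec.norm_lamZ_le`), and
`P` is read here from the plaquette variables of the two configurations `e^{A}V₀`, `V₀` — i.e. on the road from [Balaban1985RegularSpaces] (1.40) «U₀, U₁U₀ ∈ 𝔄_k({Ω_j}, α₀)» transported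
to every level by Prop. 2 (52) (SOCKET-CHECK-N2.md: «the curl is READ FROM `HThm4Rec`'s own `PlaqSmallOn` rows»).  `--kind proof --supports stmt-QuantumFields-20541` (K0⁷; count-neutral; no
definition).  Sources READ: [3] = [Balaban1985Averaging] p. 24 (44), p. 26 (52), pp. 27–28 (56)–(58), p. 34 (109)–(111) (`paper:balaban1985-cmp98-averaging`); [6] = [Balaban1985RegularSpaces]
p. 83 (1.40), p. 86 (1.56).  REUSED BY NAME: the engine's `B7Eq92Concrete.tHol` ((58) `(R_{0,y}V′)(Γ)` as the twisted transport `V′V₀(Γ)·V₀(Γ)⁻¹`), `B7Prop3GeneralRotated.tsum ∕ tstep` (its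
linearisation, `hasDerivAt_tHol_expCfg`), `B7Prop3Flat.expCfg` ((109) `V₁ = e^{A}`), `B7Prop1Explicit.norm_exp_sub_one_le_of_norm_le ∕ expRem`, `B7Prop2Explicit.pdev`.

WHAT IS PROVED (sorry-free).  §1 `stepHol_expCfg_mul` (one bond of `e^{A}V₀` is `e^{tstep}·V₀(b)^{±1}` — the reversed bond rotated, (9) + (56)), `tHol_cons'` ((58) one letter at a time from the
LEFT: `(R_{0,x}V′)(l :: Γ) = e^{tstep(l)}·R(V₀(l))[(R_{0,x+l}V′)(Γ)]`); §2 ★★`norm_tHol_expCfg_sub_one_sub_tsum_le` — `‖(R_{0,x}e^{A})(Γ) − 1 − (R_{0,x}A)(Γ)‖ ≤ e^{|Γ|a} − 1 − |Γ|a`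
(`|A| ≤ a`, `V₀ ∈ U1`; EXACT telescoping of the exponential remainders, the quantitative form of `hasDerivAt_tHol_expCfg`), `norm_tHol_expCfg_sub_one_le` (`≤ e^{|Γ|a} − 1`);
§3 ★★★`norm_tsum_plaqWord_le` — `‖(R_{0,x}A)(∂p)‖ ≤ ‖(e^{A}V₀)(∂p) − 1‖ + ‖V₀(∂p) − 1‖ + 16a²` for `4a ≤ 1`, and `norm_tsum_plaqWord_le_of_pdev` (`≤ pdev(e^{A}V₀) + pdev V₀ + 16a²`):
the covariant plaquette curl of the perturbation is controlled by the plaquette variables of the perturbed and unperturbed configurations.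
HONEST SCOPE.  Finite bookkeeping and the exponential series; nothing of [3]∕[6] asserted; `HThm4Rec` UNDISCHARGED; N05 discharged of record untouched; N07 not claimable; counts unmoved
(typed 28∕28 · discharged 8∕28); one finite 𝕋⁴ programme at fixed ε — nothing continuum ∕ ℝ⁴ ∕ OS ∕ mass gap ∕ Clay.  No `def`, no `instance`, no `notation`, no `sorry`.
-/

set_option autoImplicit false

noncomputable section

open scoped BigOperators
open NormedSpace

namespace Literature.MathematicalPhysics.QuantumFieldTheory.Balaban1983to89.B7Prop4CurlTransportRec

open B7Prop1Explicit hiding Site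
open B7Prop1Explicit renaming Site → SiteZ
open B7Prop2Explicit (pdev le_pdev pdev_nonneg)
open B7Prop3GeneralRotated
open B7Prop3Flat (expCfg)
open B7Eq92Concrete (tHol tHol_nil expUnit_conj Rc Rc_apply)
open B7Eq78Linearization (conjR conjR_apply conjR_add conjR_sub conjR_one)

variable {d : ℕ}

variable {𝔸 : Type*} [NormedRing 𝔸] [NormedAlgebra ℂ 𝔸] [NormOneClass 𝔸] [CompleteSpace 𝔸]

/-! ## §1 One bond of `e^{A}V₀`, and (58) one letter at a time from the left -/

omit [NormOneClass 𝔸] in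
/-- **One bond of the perturbed configuration**: `stepHol (e^{A}V₀) x l = e^{tstep_{V₀}(A)(x,l)} · stepHol V₀ x l` — for a positively oriented letter `e^{A_b}V₀(b)`, for a reversed one
`(e^{A_b}V₀(b))⁻¹ = e^{−R(V₀(b)⁻¹)A_b}·V₀(b)⁻¹` ((9) and the rotation (56)). [cite: Balaban1985Averaging, (9) p.18, (56) p.27, (58) p.27, (109) p.34] -/
theorem stepHol_expCfg_mul (V₀ : SiteZ d → Fin d → 𝔸ˣ) (A : SiteZ d → Fin d → 𝔸) (x : SiteZ d) (l : Letter d) :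
    stepHol (expCfg A * V₀) x l = expUnit (tstep V₀ A x l) * stepHol V₀ x l := by
  unfold stepHol tstep
  split_ifs with h
  · rfl
  · rw [Pi.mul_apply, Pi.mul_apply, mul_inv_rev, conjR_apply]
    have hneg : -(((stepHol V₀ x l : 𝔸ˣ) : 𝔸) * A (x + l.vec) l.1 * (((stepHol V₀ x l)⁻¹ : 𝔸ˣ) : 𝔸))
        = ((stepHol V₀ x l : 𝔸ˣ) : 𝔸) * (-A (x + l.vec) l.1) * (((stepHol V₀ x l)⁻¹ : 𝔸ˣ) : 𝔸) := by
      rw [mul_neg, neg_mul]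
    have hs : stepHol V₀ x l = (V₀ (x + l.vec) l.1)⁻¹ := by
      unfold stepHol; rw [if_neg h]
    rw [hneg, expUnit_conj, Rc_apply, ← hs]
    have hinv : (expCfg A (x + l.vec) l.1)⁻¹ = expUnit (-A (x + l.vec) l.1) := Units.ext rfl
    rw [hinv, mul_assoc, inv_mul_cancel, mul_one]

omit [NormedAlgebra ℂ 𝔸] [NormOneClass 𝔸] [CompleteSpace 𝔸] in
/-- **(58) one letter at a time, from the left**: `(R_{0,x}V′)(l :: Γ) = stepHol(V′V₀)(x,l) · (R_{0,x+l}V′)(Γ) · stepHol(V₀)(x,l)⁻¹`. [cite: Balaban1985Averaging, (58) p.27] -/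
theorem tHol_cons' {G : Type*} [Group G] (V₀ V₁ : SiteZ d → Fin d → G) (x : SiteZ d) (l : Letter d) (w : List (Letter d)) :
    tHol V₀ V₁ x (l :: w) = stepHol (V₁ * V₀) x l * tHol V₀ V₁ (x + l.vec) w * (stepHol V₀ x l)⁻¹ := by
  unfold tHol
  rw [hol_cons, hol_cons, mul_inv_rev]
  group

/-! ## §2 The twisted transport of `e^{A}` vs `1 + (R_{0,x}A)(Γ)`: exact telescoping of exponential remainders -/

section Remainder

variable {V₀ : SiteZ d → Fin d → 𝔸ˣ} (hV₀ : ∀ x κ, V₀ x κ ∈ U1 𝔸) {A : SiteZ d → Fin d → 𝔸} {a : ℝ} (ha : 0 ≤ a)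
  (hA : ∀ x κ, ‖A x κ‖ ≤ a)
include hV₀ ha hA

omit [NormedAlgebra ℂ 𝔸] [CompleteSpace 𝔸] ha in
/-- `‖tstep_{V₀}(A)(x, l)‖ ≤ |A|` (a reversed letter is only rotated). [cite: Balaban1985Averaging, (56)–(58) p.27] -/
theorem norm_tstep_le (x : SiteZ d) (l : Letter d) : ‖tstep V₀ A x l‖ ≤ a := by
  unfold tstep
  split_ifs
  · exact hA _ _
  · rw [norm_neg]; exact (norm_conjR_le (stepHol_mem hV₀ x l) _).trans (hA _ _)

/-- ★★ **`‖(R_{0,x}e^{A})(Γ) − 1 − (R_{0,x}A)(Γ)‖ ≤ e^{|Γ|a} − 1 − |Γ|a`** — the twisted transport (58) of `V′ = e^{A}` along any word differs from `1 +` its linearisation (the rotated sum) by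
the second-order exponential remainder of the total length; by induction from the left: `(R_{0,x}e^{A})(l :: Γ) = e^{X₁}·R(V₀(l))[(R_{0,x+l}e^{A})(Γ)]` with `X₁ = tstep(l)`, and
`e^{X₁}T′ − 1 − (X₁ + S′) = (e^{X₁} − 1 − X₁) + (T′ − 1 − S′) + (e^{X₁} − 1)(T′ − 1)` telescopes the bounds `e^{b} − 1 − b`, `e^{nb} − 1 − nb`, `(e^{b} − 1)(e^{nb} − 1)` EXACTLY into
`e^{(n+1)b} − 1 − (n+1)b`. [cite: Balaban1985Averaging, (58) p.27, (109)–(111) p.34] -/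
theorem norm_tHol_expCfg_sub_one_sub_tsum_le : ∀ (w : List (Letter d)) (x : SiteZ d),
    ‖((tHol V₀ (expCfg A) x w : 𝔸ˣ) : 𝔸) - 1 - tsum V₀ A x w‖ ≤ expRem (w.length * a)
  | [], x => by simp [expRem]
  | l :: w, x => by
    have ih := norm_tHol_expCfg_sub_one_sub_tsum_le w (x + l.vec)
    set s₀ := stepHol V₀ x l with hs₀
    set X₁ := tstep V₀ A x l with hX₁
    set T' : 𝔸 := conjR s₀ ((tHol V₀ (expCfg A) (x + l.vec) w : 𝔸ˣ) : 𝔸) with hT'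
    set S' : 𝔸 := conjR s₀ (tsum V₀ A (x + l.vec) w) with hS'
    have hs₀1 : s₀ ∈ U1 𝔸 := stepHol_mem hV₀ x l
    have hX₁a : ‖X₁‖ ≤ a := norm_tstep_le hV₀ hA x l
    have hna : 0 ≤ (w.length : ℝ) * a := by positivity
    -- the recursion (58) from the left, with one bond of `e^{A}V₀` = `e^{X₁}·V₀(b)^{±1}`
    have hT : ((tHol V₀ (expCfg A) x (l :: w) : 𝔸ˣ) : 𝔸) = exp X₁ * T' := by
      rw [tHol_cons', stepHol_expCfg_mul, hT', conjR_apply, hs₀, hX₁]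
      simp only [Units.val_mul, val_expUnit, mul_assoc]
    have hS : tsum V₀ A x (l :: w) = X₁ + S' := by rw [tsum_cons]
    -- the three pieces
    have h1 : ‖exp X₁ - 1 - X₁‖ ≤ expRem a := (norm_exp_sub_one_le_of_norm_le hX₁a).2
    have h1' : ‖exp X₁ - 1‖ ≤ Real.exp a - 1 := (norm_exp_sub_one_le_of_norm_le hX₁a).1
    have h2 : ‖T' - 1 - S'‖ ≤ expRem (w.length * a) := by
      have e : T' - 1 - S' = conjR s₀ (((tHol V₀ (expCfg A) (x + l.vec) w : 𝔸ˣ) : 𝔸) - 1 - tsum V₀ A (x + l.vec) w) := by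
        rw [conjR_sub, conjR_sub, conjR_one]
      rw [e]
      exact (norm_conjR_le hs₀1 _).trans ih
    have h3 : ‖T' - 1‖ ≤ Real.exp (w.length * a) - 1 := by
      have e : T' - 1 = (T' - 1 - S') + S' := by abel
      rw [e]
      refine (norm_add_le _ _).trans ?_
      have hS'n : ‖S'‖ ≤ w.length * a := (norm_conjR_le hs₀1 _).trans (norm_tsum_le hV₀ hA _ _)
      have := add_le_add h2 hS'n
      unfold expRem at this
      linarith
    have e : exp X₁ * T' - 1 - (X₁ + S') = (exp X₁ - 1 - X₁) + (T' - 1 - S') + (exp X₁ - 1) * (T' - 1) := by noncomm_ring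
    rw [hT, hS, e, List.length_cons, Nat.cast_succ]
    have hea : 0 ≤ Real.exp a - 1 := by linarith [Real.add_one_le_exp a]
    have hen : 0 ≤ Real.exp (w.length * a) - 1 := by linarith [Real.add_one_le_exp ((w.length : ℝ) * a)]
    calc ‖exp X₁ - 1 - X₁ + (T' - 1 - S') + (exp X₁ - 1) * (T' - 1)‖
        ≤ ‖exp X₁ - 1 - X₁‖ + ‖T' - 1 - S'‖ + ‖exp X₁ - 1‖ * ‖T' - 1‖ :=
          (norm_add_le _ _).trans (add_le_add (norm_add_le _ _) (norm_mul_le _ _))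
      _ ≤ expRem a + expRem (w.length * a) + (Real.exp a - 1) * (Real.exp (w.length * a) - 1) := by
          gcongr
      _ = expRem ((w.length + 1) * a) := by
          unfold expRem
          rw [add_mul, one_mul, Real.exp_add]
          ring

/-- Hence `‖(R_{0,x}e^{A})(Γ) − 1‖ ≤ e^{|Γ|a} − 1`. [cite: Balaban1985Averaging, (58) p.27, (109)–(111) p.34] -/
theorem norm_tHol_expCfg_sub_one_le (w : List (Letter d)) (x : SiteZ d) :
    ‖((tHol V₀ (expCfg A) x w : 𝔸ˣ) : 𝔸) - 1‖ ≤ Real.exp (w.length * a) - 1 := by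
  have h := norm_tHol_expCfg_sub_one_sub_tsum_le hV₀ ha hA w x
  have e : ((tHol V₀ (expCfg A) x w : 𝔸ˣ) : 𝔸) - 1 = (((tHol V₀ (expCfg A) x w : 𝔸ˣ) : 𝔸) - 1 - tsum V₀ A x w) + tsum V₀ A x w := by abel
  rw [e]
  have := add_le_add h (norm_tsum_le hV₀ hA x w)
  unfold expRem at this
  exact (norm_add_le _ _).trans (by linarith)

end Remainder

/-! ## §3 The covariant plaquette curl from the plaquette variables of `e^{A}V₀` and `V₀` -/

section Curl

variable {V₀ : SiteZ d → Fin d → 𝔸ˣ} (hV₀ : ∀ x κ, V₀ x κ ∈ U1 𝔸) {A : SiteZ d → Fin d → 𝔸} {a : ℝ} (ha : 0 ≤ a)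
  (hA : ∀ x κ, ‖A x κ‖ ≤ a)
include hV₀ ha hA

/-- ★★★ **THE COVARIANT PLAQUETTE CURL OF THE PERTURBATION, READ FROM PLAQUETTE VARIABLES**: for `|A| ≤ a` with `4a ≤ 1` and `V₀ ∈ U1`,
`‖(R_{0,x}A)(∂p)‖ ≤ ‖(e^{A}V₀)(∂p) − 1‖ + ‖V₀(∂p) − 1‖ + 16a²` — since `(R_{0,x}e^{A})(∂p) = (e^{A}V₀)(∂p)·V₀(∂p)⁻¹` and `‖(R_{0,x}e^{A})(∂p) − 1 − (R_{0,x}A)(∂p)‖ ≤ e^{4a} − 1 − 4a ≤ 16a²`.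
On the road: `A` = the level-`j` exponent, `e^{A}V₀ = (U₁U₀)‾^j` up to the frame gauge, `V₀ = Ū₀^j`, both with plaquettes `< 2α₀L^{2(j−k)}` by [6] (1.40) and Prop. 2.
[cite: Balaban1985Averaging, (44) p.24, (58) p.27; Balaban1985RegularSpaces, (1.40) p.83, (1.56) p.86] -/
theorem norm_tsum_plaqWord_le (ha4 : 4 * a ≤ 1) (x : SiteZ d) (μ ν : Fin d) :
    ‖tsum V₀ A x (plaqWord μ ν)‖ ≤ ‖((hol (expCfg A * V₀) x (plaqWord μ ν) : 𝔸ˣ) : 𝔸) - 1‖ + ‖((hol V₀ x (plaqWord μ ν) : 𝔸ˣ) : 𝔸) - 1‖ + 16 * a ^ 2 := by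
  have h := norm_tHol_expCfg_sub_one_sub_tsum_le hV₀ ha hA (plaqWord μ ν) x
  have hlen : ((plaqWord μ ν).length : ℝ) = 4 := by norm_num [plaqWord]
  rw [hlen] at h
  -- `expRem (4a) ≤ (4a)² = 16a²`
  have hrem : expRem (4 * a) ≤ 16 * a ^ 2 := by
    have h4 : |4 * a| ≤ 1 := by rw [abs_of_nonneg (by linarith)]; exact ha4
    have := Real.abs_exp_sub_one_sub_id_le h4
    unfold expRem
    calc Real.exp (4 * a) - 1 - 4 * a ≤ |Real.exp (4 * a) - 1 - 4 * a| := le_abs_self _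
      _ ≤ (4 * a) ^ 2 := this
      _ = 16 * a ^ 2 := by ring
  -- `‖(R_{0,x}e^{A})(∂p) − 1‖ ≤ ‖(e^{A}V₀)(∂p) − 1‖ + ‖V₀(∂p) − 1‖`
  have hT : ‖((tHol V₀ (expCfg A) x (plaqWord μ ν) : 𝔸ˣ) : 𝔸) - 1‖
      ≤ ‖((hol (expCfg A * V₀) x (plaqWord μ ν) : 𝔸ˣ) : 𝔸) - 1‖ + ‖((hol V₀ x (plaqWord μ ν) : 𝔸ˣ) : 𝔸) - 1‖ := by
    set H₁ := hol (expCfg A * V₀) x (plaqWord μ ν) with hH₁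
    set H₀ := hol V₀ x (plaqWord μ ν) with hH₀
    have hH₀1 : H₀ ∈ U1 𝔸 := hol_mem hV₀ _ _
    obtain ⟨_, hinv⟩ := mem_U1.1 hH₀1
    have e : ((tHol V₀ (expCfg A) x (plaqWord μ ν) : 𝔸ˣ) : 𝔸) - 1 = (((H₁ : 𝔸ˣ) : 𝔸) - 1 - (((H₀ : 𝔸ˣ) : 𝔸) - 1)) * (((H₀⁻¹ : 𝔸ˣ)) : 𝔸) := by
      unfold tHol
      rw [← hH₁, ← hH₀, Units.val_mul, sub_sub_sub_cancel_right, sub_mul, Units.mul_inv]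
    rw [e]
    calc ‖(((H₁ : 𝔸ˣ) : 𝔸) - 1 - (((H₀ : 𝔸ˣ) : 𝔸) - 1)) * (((H₀⁻¹ : 𝔸ˣ)) : 𝔸)‖
        ≤ ‖((H₁ : 𝔸ˣ) : 𝔸) - 1 - (((H₀ : 𝔸ˣ) : 𝔸) - 1)‖ * ‖(((H₀⁻¹ : 𝔸ˣ)) : 𝔸)‖ := norm_mul_le _ _
      _ ≤ (‖((H₁ : 𝔸ˣ) : 𝔸) - 1‖ + ‖((H₀ : 𝔸ˣ) : 𝔸) - 1‖) * 1 := by gcongr; exact norm_sub_le _ _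
      _ = _ := by ring
  have e2 : tsum V₀ A x (plaqWord μ ν)
      = (((tHol V₀ (expCfg A) x (plaqWord μ ν) : 𝔸ˣ) : 𝔸) - 1) - (((tHol V₀ (expCfg A) x (plaqWord μ ν) : 𝔸ˣ) : 𝔸) - 1 - tsum V₀ A x (plaqWord μ ν)) := by
    abel
  rw [e2]
  refine (norm_sub_le _ _).trans ?_
  linarith

/-- The same with the plaquette deviations `pdev` of the lineage: `‖(R_{0,x}A)(∂p)‖ ≤ pdev(e^{A}V₀) + pdev V₀ + 16a²` (`e^{A}V₀ ∈ U1` for the sup to be attained bondwise; on the road both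
configurations lie in the averaging-closed structure group). [cite: Balaban1985Averaging, (44) p.24, (52) p.26, (58) p.27; Balaban1985RegularSpaces, (1.40) p.83] -/
theorem norm_tsum_plaqWord_le_of_pdev (ha4 : 4 * a ≤ 1) (hAV : ∀ x κ, (expCfg A * V₀) x κ ∈ U1 𝔸) (x : SiteZ d) (μ ν : Fin d) :
    ‖tsum V₀ A x (plaqWord μ ν)‖ ≤ pdev (expCfg A * V₀) + pdev V₀ + 16 * a ^ 2 :=
  (norm_tsum_plaqWord_le hV₀ ha hA ha4 x μ ν).trans (by linarith [le_pdev hAV x μ ν, le_pdev hV₀ x μ ν])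

end Curl

end Literature.MathematicalPhysics.QuantumFieldTheory.Balaban1983to89.B7Prop4CurlTransportRec
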